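import Summits.PneNP.PneNP.Theorems.CliqueExtLowerBound.Negative.LoadBearing
import Literature.Computability.Complexity.ExtMonotoneCircuits

/-!
# `CliqueExtLowerBound` (stmt-PneNP-10682) — negative side: apex padding of extended monotone circuits

Standing-adversary (cdisprove, gen 3) output for the crux
`Summit.PneNP.PneNP.Theses.ConvexRankGates.CliqueExtLowerBound`
(`∃ δ ∈ (0,1/2), LowerBoundAt ⌈m^δ⌉₊` over the FULL basis `B_{m^c} = {∧₂,∨₂} ∪ CONV ∪ PERM ∪ GRANK`,
bridge `cliqueExtLowerBound_iff` of `LoadBearing.lean`).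

APEX PADDING: `CLIQUE(m', k')` is the restriction of `CLIQUE(m, k' + (m - m'))` that switches on every
edge at the `m - m'` new vertices (`cliqueFn_padVec`), and a restriction of a `B_s`-circuit is a
`B_s`-circuit with `≤ #E(K_m)` extra gates (constants are GRANK gates of dimension `0`,
`constTrue_mem_extGate`, and CONV gates of width `0`, `isConvGate_constTrue`; `cktSize_padVec`,
`exists_circuit_padVec` work over ANY basis containing the arity-0 constant `true`). Hence the SCHEDULE
TRANSFER, stated for an arbitrary basis family monotone in the size parameter (`LowerBoundAtOver`, so
that cruxes #2 `ConvexGateBlind` and #4 `LinAlgGateBlind` are covered by the same theorem) and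
specialised to the crux (`LowerBoundAt = LowerBoundAtOver extGate`): `not_lowerBoundAtOver_of_padding` /
`LowerBoundAtOver.of_padding` / `not_lowerBoundAt_of_padding` / `LowerBoundAt.of_padding` — if eventually
every `m` has an `m' ≤ m ≤ m'^2`, `m' ≥ 2`, with `k m = k' m' + (m - m')`, then hardness at `k'` gives
hardness at `k` (a polynomial circuit for `CLIQUE(m, k m)` infinitely often restricts to one for
`CLIQUE(m', k' m')` infinitely often; exponent `c ↦ 2c + 5`). Sequel: `DeltaMonotone.lean` (the hard band
`⌈m^δ⌉₊ ≤ k ≤ m - √m - 1`, monotonicity in `δ`, interval read-back of the crux, widened refutation targets).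

The combinatorial padding lemmas follow the sibling seat's treatment for the CONV-only crux
(Cruxes/ConvexGateBlind/Disproof.lean §E, cdisprove-10680 gen 2, where gate DATA are padded); here
CIRCUITS over the full basis are padded. Refuter seat cdisprove-stmt-PneNP-10682-g3, 2026-08-16.
-/

namespace Summit.PneNP.PneNP.Theorems.CliqueExtLowerBound.Negative

open Literature.Computability.Complexity Filter Finset
open Summit.PneNP.PneNP.Theses.ConvexRankGates (CliqueExtLowerBound)

/-! ## §1 Apex padding of the clique function -/

section Padding

/-- Edge slots of `K_m`. [folklore] -/
abbrev E (m : ℕ) : Type := (⊤ : SimpleGraph (Fin m)).edgeSet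

variable {m' m : ℕ} (hm : m' ≤ m)

/-- The edge of `K_m` over an edge of `K_{m'}` (`m' ≤ m`, vertices embedded by `Fin.castLE`). [folklore] -/
def padEdge (e : E m') : E m :=
  ⟨(e : Sym2 (Fin m')).map (Fin.castLE hm), by
    obtain ⟨e, he⟩ := e
    induction e using Sym2.ind with
    | h a b =>
      have hab : a ≠ b := (SimpleGraph.top_adj a b).1 ((SimpleGraph.mem_edgeSet ⊤).1 he)
      rw [Sym2.map_mk, SimpleGraph.mem_edgeSet, SimpleGraph.top_adj]
      exact fun h => hab (Fin.castLE_injective hm h)⟩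

/-- `padEdge` is injective. [folklore] -/
theorem padEdge_injective : Function.Injective (padEdge hm) := by
  intro e₁ e₂ h
  apply Subtype.ext
  have h' := congrArg Subtype.val h
  exact Sym2.map.injective (Fin.castLE_injective hm) h'

open scoped Classical in
/-- Extension of an edge vector of `K_{m'}` to `K_m`: live edges keep their value, every edge at an
apex vertex is switched on. [folklore] -/
noncomputable def padVec (x' : E m' → Bool) (e : E m) : Bool :=
  if h : ∃ e', padEdge hm e' = e then x' h.choose else true

/-- Live edges keep their value. [folklore] -/
theorem padVec_padEdge (x' : E m' → Bool) (e' : E m') : padVec hm x' (padEdge hm e') = x' e' := by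
  classical
  unfold padVec
  have h : ∃ e'', padEdge hm e'' = padEdge hm e' := ⟨e', rfl⟩
  rw [dif_pos h, padEdge_injective hm h.choose_spec]

/-- Apex edges are on. [folklore] -/
theorem padVec_of_not_range (x' : E m' → Bool) (e : E m) (he : ∀ e', padEdge hm e' ≠ e) :
    padVec hm x' e = true := by
  classical
  unfold padVec
  rw [dif_neg fun ⟨e', h⟩ => he e' h]

/-- An edge of `K_m` both of whose endpoints are live is in the range of `padEdge`. [folklore] -/
theorem exists_padEdge_of_lt {u v : Fin m} (huv : s(u, v) ∈ (⊤ : SimpleGraph (Fin m)).edgeSet)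
    (hu : (u : ℕ) < m') (hv : (v : ℕ) < m') : ∃ e', padEdge hm e' = ⟨s(u, v), huv⟩ := by
  have hne : u ≠ v := (SimpleGraph.top_adj u v).1 ((SimpleGraph.mem_edgeSet ⊤).1 huv)
  have hne' : (⟨u, hu⟩ : Fin m') ≠ ⟨v, hv⟩ := fun h => hne (Fin.ext (Fin.mk.inj_iff.1 h))
  refine ⟨⟨s(⟨u, hu⟩, ⟨v, hv⟩), (SimpleGraph.mem_edgeSet ⊤).2 ((SimpleGraph.top_adj _ _).2 hne')⟩,
    Subtype.ext ?_⟩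
  simp [padEdge, Fin.castLE]

/-- An edge in the range of `padEdge` has live endpoints. [folklore] -/
theorem lt_of_padEdge_eq {u v : Fin m} {huv : s(u, v) ∈ (⊤ : SimpleGraph (Fin m)).edgeSet}
    {e' : E m'} (h : padEdge hm e' = ⟨s(u, v), huv⟩) : (u : ℕ) < m' ∧ (v : ℕ) < m' := by
  obtain ⟨e', he'⟩ := e'
  induction e' using Sym2.ind with
  | h a b =>
    have h' := congrArg Subtype.val h
    simp only [padEdge, Sym2.map_mk] at h'
    rcases Sym2.eq_iff.1 h' with ⟨rfl, rfl⟩ | ⟨rfl, rfl⟩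
    · exact ⟨a.2, b.2⟩
    · exact ⟨b.2, a.2⟩

/-- **Apex padding.** `CLIQUE(m, k' + (m - m'))` on the extended vector is `CLIQUE(m', k')`: a clique of
the padded graph loses at most the `m - m'` apexes when restricted to the live part, and a live clique
plus all apexes is a clique of the padded graph. [folklore] -/
theorem cliqueFn_padVec (x' : E m' → Bool) (k' : ℕ) :
    cliqueFn m (k' + (m - m')) (padVec hm x') = cliqueFn m' k' x' := by
  classical
  rw [Bool.eq_iff_iff, CliqueLPGate.cliqueFn_eq_true_iff_exists,
    CliqueLPGate.cliqueFn_eq_true_iff_exists]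
  -- the apex (dead) vertices
  set Dd : Finset (Fin m) := Finset.univ.filter fun v => m' ≤ (v : ℕ) with hDd
  have hDcard : Dd.card = m - m' := by
    have h1 : Dd = Finset.univ \ Finset.univ.map (Fin.castLEEmb hm) := by
      ext v
      simp only [hDd, Finset.mem_filter, Finset.mem_univ, true_and, Finset.mem_sdiff,
        Finset.mem_map, Fin.castLEEmb_apply, not_exists]
      constructor
      · intro hv a ha
        have : ((Fin.castLE hm a : Fin m) : ℕ) = v := by rw [ha]
        simp at this; omega
      · intro h
        by_contra hlt
        push Not at hlt
        exact h ⟨v, hlt⟩ (Fin.ext rfl)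
    rw [h1, Finset.card_sdiff_of_subset (Finset.subset_univ _), Finset.card_map, Finset.card_univ,
      Finset.card_univ, Fintype.card_fin, Fintype.card_fin]
  constructor
  · -- a clique of the padded graph restricts to a clique of the live part
    rintro ⟨S, hS, hx⟩
    set T : Finset (Fin m') := Finset.univ.filter fun a => Fin.castLE hm a ∈ S with hT
    have hTcard : k' ≤ T.card := by
      have hsub : S ⊆ T.map (Fin.castLEEmb hm) ∪ Dd := by
        intro v hv
        by_cases hlt : (v : ℕ) < m'
        · refine Finset.mem_union_left _ (Finset.mem_map.2 ⟨⟨v, hlt⟩, ?_, Fin.ext rfl⟩)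
          simp only [hT, Finset.mem_filter, Finset.mem_univ, true_and]
          have : Fin.castLE hm ⟨v, hlt⟩ = v := Fin.ext rfl
          rwa [this]
        · exact Finset.mem_union_right _ (by simp [hDd]; omega)
      have := (Finset.card_le_card hsub).trans (Finset.card_union_le _ _)
      rw [Finset.card_map, hDcard, hS] at this
      omega
    obtain ⟨T₀, hT₀T, hT₀⟩ := Finset.exists_subset_card_eq hTcard
    refine ⟨T₀, hT₀, fun e' he' => ?_⟩
    obtain ⟨e', heE⟩ := e'
    induction e' using Sym2.ind with
    | h a b =>
      have ha : Fin.castLE hm a ∈ S := by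
        have := hT₀T (he' a (Sym2.mem_mk_left a b)); simp [hT] at this; exact this
      have hb : Fin.castLE hm b ∈ S := by
        have := hT₀T (he' b (Sym2.mem_mk_right a b)); simp [hT] at this; exact this
      rw [← padVec_padEdge hm x']
      refine hx _ fun y hy => ?_
      simp only [padEdge, Sym2.map_mk, Sym2.mem_iff] at hy
      rcases hy with rfl | rfl
      · exact ha
      · exact hb
  · -- a live clique plus all apexes is a clique of the padded graph
    rintro ⟨T, hT, hx⟩
    refine ⟨T.map (Fin.castLEEmb hm) ∪ Dd, ?_, fun e he => ?_⟩
    · rw [Finset.card_union_of_disjoint, Finset.card_map, hT, hDcard]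
      rw [Finset.disjoint_left]
      intro v hv hvD
      obtain ⟨a, -, rfl⟩ := Finset.mem_map.1 hv
      simp [hDd, Fin.castLEEmb] at hvD
      exact absurd a.2 (not_lt.2 hvD)
    · obtain ⟨e, heE⟩ := e
      induction e using Sym2.ind with
      | h u v =>
        by_cases hlive : (u : ℕ) < m' ∧ (v : ℕ) < m'
        · obtain ⟨e', he'⟩ := exists_padEdge_of_lt hm heE hlive.1 hlive.2
          rw [← he', padVec_padEdge]
          apply hx
          intro y hy
          have hu := he _ (Sym2.mem_mk_left u v)
          have hv := he _ (Sym2.mem_mk_right u v)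
          have key : ∀ w : Fin m, w ∈ T.map (Fin.castLEEmb hm) ∪ Dd → (w : ℕ) < m' →
              ∀ a : Fin m', Fin.castLE hm a = w → a ∈ T := by
            intro w hw hwlt a ha
            rcases Finset.mem_union.1 hw with hw | hw
            · obtain ⟨a', ha', rfl⟩ := Finset.mem_map.1 hw
              have : a = a' := Fin.castLE_injective hm (by rw [ha]; rfl)
              rwa [this]
            · simp [hDd] at hw; omega
          obtain ⟨e'v, he'E⟩ := e'
          induction e'v using Sym2.ind with
          | h a b =>
            have h' := congrArg Subtype.val he'
            simp only [padEdge, Sym2.map_mk] at h'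
            simp only [Sym2.mem_iff] at hy
            rcases Sym2.eq_iff.1 h' with ⟨hau, hbv⟩ | ⟨hav, hbu⟩
            · rcases hy with rfl | rfl
              · exact key u hu hlive.1 _ hau
              · exact key v hv hlive.2 _ hbv
            · rcases hy with rfl | rfl
              · exact key v hv hlive.2 _ hav
              · exact key u hu hlive.1 _ hbu
        · apply padVec_of_not_range
          intro e' h
          exact hlive (lt_of_padEdge_eq hm h)

end Padding

/-! ## §2 Padding a circuit over any basis containing the constant `true` -/

section Circuits

/-- The constant `true` of any arity is a GRANK gate of dimension `0` (threshold `θ = 0`). [folklore] -/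
theorem isGRankGate_constTrue (n : ℕ) : IsGRankGate 0 ⟨n, fun _ => true⟩ :=
  ⟨ℚ, inferInstance, 0, 0, le_rfl, 0, 0, fun _ => by simp⟩

/-- The constant `true` of any arity is a CONV gate of width `0` (`p = q = 0`: the empty SDP is feasible).
[folklore] -/
theorem isConvGate_constTrue (n : ℕ) : IsConvGate 0 ⟨n, fun _ => true⟩ :=
  ⟨0, 0, le_rfl, fun i => i.elim0, fun i => i.elim0, fun i => i.elim0, fun i => i.elim0, fun _ =>
    ⟨fun _ => ⟨0, Matrix.PosSemidef.zero, fun i => i.elim0⟩, fun _ => rfl⟩⟩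

/-- The constant `true` of any arity lies in the extended basis `B_s` for every `s`. [folklore] -/
theorem constTrue_mem_extGate (s n : ℕ) : (⟨n, fun _ => true⟩ : GateFn) ∈ extGate s :=
  ((isGRankGate_constTrue n).mono (Nat.zero_le s)).mem_extGate

/-- A circuit is a straight-line program realising its own function (converse of
`CktSize.toCircuit`). [folklore] -/
theorem cktSize_ofCircuit {ι : Type*} {B : Set GateFn} (C : Circuit ι) (hB : C.IsOver B) :
    CktSize B (fun x (_ : Unit) => C.eval x) C.size :=
  ⟨C.gates, fun _ => C.output, le_rfl,
    ⟨GateList.wf_gates C, hB, fun _ n hn => C.wf_output n hn,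
      fun x _ => (GateList.circuit_eval C x).symm⟩⟩

variable {m' m : ℕ} (hm : m' ≤ m)

/-- The padding map `x' ↦ padVec x'` costs at most `#E(K_m)` gates over any basis `B` containing the
arity-`0` constant `true` (a projection for a live edge, one constant gate for an apex edge). [folklore] -/
theorem cktSize_padVec {B : Set GateFn} (hB : (⟨0, fun _ => true⟩ : GateFn) ∈ B) :
    CktSize B (fun (x' : E m' → Bool) (e : E m) => padVec hm x' e) (Fintype.card (E m) * 1) := by
  classical
  refine CktSize.pi_const fun e => ?_
  by_cases h : ∃ e', padEdge hm e' = e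
  · refine ((CktSize.proj B fun _ : Unit => h.choose).of_le (Nat.zero_le 1)).congr fun x' _ => ?_
    show x' h.choose = padVec hm x' e
    unfold padVec
    rw [dif_pos h]
  · refine (CktSize.gate (B := B) (⟨0, fun _ => true⟩ : GateFn) hB Fin.elim0).congr fun x' _ => ?_
    show true = padVec hm x' e
    unfold padVec
    rw [dif_neg h]

/-- **Restriction of a circuit along the padding**: a `B`-circuit on the edges of `K_m` computing `f`
yields a `B`-circuit on the edges of `K_{m'}` computing `x' ↦ f (padVec x')`, with at most `#E(K_m)` extra
gates, for any basis `B` containing the arity-`0` constant `true`. [folklore] -/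
theorem exists_circuit_padVec {B : Set GateFn} (hB : (⟨0, fun _ => true⟩ : GateFn) ∈ B)
    (C : Circuit (E m)) (hC : C.IsOver B) {f : (E m → Bool) → Bool} (hf : C.Computes f) :
    ∃ C' : Circuit (E m'), C'.IsOver B ∧ C'.size ≤ Fintype.card (E m) + C.size ∧
      C'.Computes fun x' => f (padVec hm x') := by
  obtain ⟨C', hC', hs, he⟩ := ((cktSize_padVec hm hB).comp (cktSize_ofCircuit C hC)).toCircuit
  refine ⟨C', hC', by simpa using hs, fun x' => ?_⟩
  rw [he x']
  exact hf _

end Circuits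

/-! ## §3 Schedule transfer by padding, over any monotone basis family with constants -/

section Transfer

/-- Lower bound at schedule `k` over a basis FAMILY `basis : ℕ → Set GateFn` (size parameter ↦ basis):
for every `c`, eventually no `basis (m^c)`-circuit with `≤ m^c` gates computes `CLIQUE(m, k m)`. The
crux's `LowerBoundAt` is the case `basis = extGate` (`lowerBoundAt_iff_over`); cruxes #2 / #4
(`ConvexGateBlind`, `LinAlgGateBlind`) are the CONV-only / PERM+GRANK-only families. [folklore] -/
def LowerBoundAtOver (basis : ℕ → Set GateFn) (k : ℕ → ℕ) : Prop :=
  ∀ c : ℕ, ∀ᶠ m : ℕ in atTop, ∀ C : Circuit ((⊤ : SimpleGraph (Fin m)).edgeSet),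
    C.IsOver (basis (m ^ c)) → C.size ≤ m ^ c → ¬ C.Computes (cliqueFn m (k m))

/-- `LowerBoundAt k` is `LowerBoundAtOver extGate k` (definitional). [folklore] -/
theorem lowerBoundAt_iff_over {k : ℕ → ℕ} : LowerBoundAt k ↔ LowerBoundAtOver extGate k := Iff.rfl

/-- `#E(K_m) ≤ m^2`. [folklore] -/
theorem card_E_le (m : ℕ) : Fintype.card (E m) ≤ m ^ 2 := CliqueLPGate.nE_le m

/-- Size bookkeeping: `m^2 + m^c ≤ m'^(2c+5)` once `m ≤ m'^2` and `2 ≤ m'`. [folklore] -/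
theorem pad_size_le {m m' c : ℕ} (hmm : m ≤ m' ^ 2) (h2 : 2 ≤ m') :
    m ^ 2 + m ^ c ≤ m' ^ (2 * c + 5) := by
  have h1 : 1 ≤ m' := by omega
  have hc : m ^ c ≤ m' ^ (2 * c + 4) :=
    calc m ^ c ≤ (m' ^ 2) ^ c := Nat.pow_le_pow_left hmm c
      _ = m' ^ (2 * c) := by rw [← pow_mul]
      _ ≤ m' ^ (2 * c + 4) := Nat.pow_le_pow_right h1 (by omega)
  have h2' : m ^ 2 ≤ m' ^ (2 * c + 4) :=
    calc m ^ 2 ≤ (m' ^ 2) ^ 2 := Nat.pow_le_pow_left hmm 2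
      _ = m' ^ 4 := by rw [← pow_mul]
      _ ≤ m' ^ (2 * c + 4) := Nat.pow_le_pow_right h1 (by omega)
  calc m ^ 2 + m ^ c ≤ m' ^ (2 * c + 4) + m' ^ (2 * c + 4) := add_le_add h2' hc
    _ = 2 * m' ^ (2 * c + 4) := by ring
    _ ≤ m' * m' ^ (2 * c + 4) := Nat.mul_le_mul_right _ h2
    _ = m' ^ (2 * c + 5) := by ring

/-- **Padding transfers refutations downward in the schedule** (generic basis family, monotone in the
size parameter and containing the arity-`0` constant `true` at every level). If eventually every `m`
admits an `m' ≤ m ≤ m'^2`, `m' ≥ 2`, with `k m = k' m' + (m - m')`, then a polynomial circuit family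
computing `CLIQUE(m, k m)` infinitely often restricts (`exists_circuit_padVec`, `cliqueFn_padVec`) to one
computing `CLIQUE(m', k' m')` infinitely often. [folklore] -/
theorem not_lowerBoundAtOver_of_padding {basis : ℕ → Set GateFn} (hmono : Monotone basis)
    (hconst : ∀ s, (⟨0, fun _ => true⟩ : GateFn) ∈ basis s) {k k' : ℕ → ℕ}
    (H : ∀ᶠ m : ℕ in atTop, ∃ m', m' ≤ m ∧ m ≤ m' ^ 2 ∧ 2 ≤ m' ∧ k m = k' m' + (m - m'))
    (h : ¬ LowerBoundAtOver basis k) : ¬ LowerBoundAtOver basis k' := by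
  simp only [LowerBoundAtOver, not_forall, Filter.not_eventually, not_not] at h ⊢
  obtain ⟨c, hc⟩ := h
  refine ⟨2 * c + 5, ?_⟩
  rw [Filter.frequently_atTop]
  intro N
  obtain ⟨m, ⟨⟨m', hm'm, hmm', h2, hk⟩, hmN⟩, C, hC, hsize, hcomp⟩ :=
    ((H.and (eventually_ge_atTop (N ^ 2))).and_frequently hc).exists
  have hN : N ≤ m' := by
    by_contra hlt
    push Not at hlt
    have : m' ^ 2 < N ^ 2 := Nat.pow_lt_pow_left hlt (by norm_num)
    omega
  refine ⟨m', hN, ?_⟩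
  obtain ⟨C', hC', hs', hcomp'⟩ := exists_circuit_padVec hm'm (hconst _) C hC hcomp
  refine ⟨C', hC'.mono (hmono ?_), ?_, fun x' => ?_⟩
  · exact le_trans (Nat.le_add_left _ _) (pad_size_le (c := c) hmm' h2)
  · exact hs'.trans ((add_le_add (card_E_le m) hsize).trans (pad_size_le hmm' h2))
  · rw [hcomp' x']
    dsimp only
    rw [hk, cliqueFn_padVec]

/-- **Hardness propagates upward along paddings** (generic, contrapositive form). [folklore] -/
theorem LowerBoundAtOver.of_padding {basis : ℕ → Set GateFn} (hmono : Monotone basis)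
    (hconst : ∀ s, (⟨0, fun _ => true⟩ : GateFn) ∈ basis s) {k k' : ℕ → ℕ}
    (h : LowerBoundAtOver basis k')
    (H : ∀ᶠ m : ℕ in atTop, ∃ m', m' ≤ m ∧ m ≤ m' ^ 2 ∧ 2 ≤ m' ∧ k m = k' m' + (m - m')) :
    LowerBoundAtOver basis k := by
  by_contra hk
  exact not_lowerBoundAtOver_of_padding hmono hconst H hk h

/-- The extended basis is monotone in its size parameter. [folklore] -/
theorem extGate_monotoneFamily : Monotone extGate := fun _ _ hst => extGate_mono hst

/-- The crux's case: `¬ LowerBoundAt k → ¬ LowerBoundAt k'` under the padding hypothesis. [folklore] -/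
theorem not_lowerBoundAt_of_padding {k k' : ℕ → ℕ}
    (H : ∀ᶠ m : ℕ in atTop, ∃ m', m' ≤ m ∧ m ≤ m' ^ 2 ∧ 2 ≤ m' ∧ k m = k' m' + (m - m'))
    (h : ¬ LowerBoundAt k) : ¬ LowerBoundAt k' :=
  not_lowerBoundAtOver_of_padding extGate_monotoneFamily (fun s => constTrue_mem_extGate s 0) H h

/-- The crux's case: hardness propagates upward along paddings. [folklore] -/
theorem LowerBoundAt.of_padding {k k' : ℕ → ℕ} (h : LowerBoundAt k')
    (H : ∀ᶠ m : ℕ in atTop, ∃ m', m' ≤ m ∧ m ≤ m' ^ 2 ∧ 2 ≤ m' ∧ k m = k' m' + (m - m')) :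
    LowerBoundAt k := by
  by_contra hk
  exact not_lowerBoundAt_of_padding H hk h

end Transfer

end Summit.PneNP.PneNP.Theorems.CliqueExtLowerBound.Negative
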